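import Mathlib
import Summits.AtomisticToContinuum.FouriersLaw.Theses.JunctionLocality
import Summits.AtomisticToContinuum.FouriersLaw.Theorems.JunctionLocalitySuperadditiveResistanceDeviceLiouville

/-!
# Line `floating-probe-bypass-laplacian` — skeleton v2 (EQUILIBRIUM KUBO FRAME) for the crux
`JunctionLocality.SuperadditiveResistance` (crux item stmt-AtomisticToContinuum-11748, rank 2 "the bet";
routes `route-AtomisticToContinuum-JunctionLocality` (primary), `route-AtomisticToContinuum-ParityLiouvilleSeed`)

Second line lead prover-line-stmt-AtomisticToContinuum-11748-b-0, 2026-08-16 (v1 = crux-plan skeleton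
`Lines/floating-probe-bypass-laplacian.lean` of planner-cruxplan-…-floating-probe-bypas-0).

Crux (FIXED, concluded BY NAME below): along unique weak steady-state families of `pinnedChain ω₂ lam β γ`
(all `> 0`), for every `T > 0` and response coefficients `D_N > 0` (`N ≥ 2`):
`∃ C ∀ N M ≥ 2, R_N + R_M − C ≤ R_{N+M}` with `R_N := (N−1)/D_N`.

## The line (unchanged idea, re-framed)

DO NOT CUT: realise the surgery inside ONE device — the `(N+M)`-chain with its junction bond kept and two
extra Langevin thermostats of the baths' own friction `γ` on the junction momenta `p_{N−1}, p_N` (the SAME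
device as line `thermalise-then-cut-probe-insertion`; its equilibrium generator is the landed
`DeviceLiouville.deviceGenerator … (fun _ => T)`). Read the insertion cost off a three-terminal ONSAGER
LAPLACIAN `𝓛` (terminals `L` = site `0`, `m` = the merged pair, `R` = site `N+M−1`): with `a = 𝓛_LL`,
`b = 𝓛_RR`, `x = −𝓛_LR` and the floating conductance `G_dev = (ab − x²)/(a + b − 2x)`,
`R_N + R_M − R_{N+M} = (R_N − 1/a) + (R_M − 1/b) + (1/a + 1/b − 1/G_dev) + (1/G_dev − R_{N+M})`,
the third leg being PROVED algebra (`series_defect_le`).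

## What changed in v2 (RESHAPE by the lead, before the first wave)

The composition needs only SOME Onsager Laplacian whose entries satisfy the three legs. v1 obtained it as
the Fréchet derivative of the terminal powers of the device's NON-EQUILIBRIUM steady states (stubs S0a:
4-bath network existence + weak-FP uniqueness; S0b: differentiability + Onsager structure) — the heaviest
fixed-`N` baggage in the tree's neighbourhood (the 2-bath existence alone is ~20 kLoC; weak-FP uniqueness is
the open route support `NessUnique`). v2 takes instead the EQUILIBRIUM KUBO MATRIX
`K_ab = γ δ_ab − (γ²/T²) ⟨g_a, p_{s_b}² − T⟩_{μ_T}` built from the FORWARD FIELDS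
`g_a = (−L_dev)⁻¹(p_{s_a}² − T)` (classical `C² ∩ L²(μ_T)` solutions; terminal sites
`s = (0, N−1, N, N+M−1)`), merged over the pair. Its Onsager-Laplacian structure is a registered stub
(`stub_kuboOnsager`, held by the lead, proof in progress: symmetry by momentum reversal, zero row sums by
energy conservation `⟨g_a, L H⟩ = −⟨p_{s_a}² − T, H⟩`, positive semidefiniteness and kernel = constants by the
identity `Σ_a ‖∂_{p_{s_a}} g_θ‖² + Σ_a ‖∂_{p_{s_a}}(g_θ − φ_θ)‖² = T|θ|²/γ²` plus the landed Liouville propagation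
`fderiv_eq_zero_of_liouville`); uniqueness of forward fields is ALREADY LANDED (`forwardField_unique`).
The device NESS, its uniqueness and its differentiability have left the skeleton. The crux's own `D` enters
through ONE fixed-`N` stub, the Kubo link `D_L/(L−1) = γ(1 − (γ/T²)⟨g^{plain}_0, p_0² − T⟩)` along the crux's
unique NESS family (`stub_plainKuboLink`), and the three legs S1–S3 are now statements about equilibrium
Poisson problems only (no NESS, no `D`).

## Registered stubs (7 = stubs_max)

* `stub_plainForwardField` (S0a, fixed-`N`) — existence of the plain `L`-chain's equilibrium forward field of
  the left bath, `L ≥ 2`.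
* `stub_deviceForwardFields` (S0b, fixed-`N`) — existence of the device's four terminal forward fields,
  `N, M ≥ 2` (shared with the first lead's `stub_linearResponse` (iv)/(v); spec = its `IsForwardField` minus
  the unused `S_K gb ∈ L²` clause).
* `stub_plainKuboLink` (S0c, fixed-`N`, the only stub that sees the crux's NESS family) — the finite-volume
  Kubo formula for the crux's response coefficient.
* `stub_kuboOnsager` (S0d, fixed-`N`, HELD BY THE LEAD) — the device's 4-terminal Kubo matrix is an Onsager
  Laplacian (symmetric, zero row sums, PSD, kernel = constants).
* `stub_terminationLocality` (S1, the bet, XL), `stub_bypassBound` (S2, the bet, L–XL),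
  `stub_probeRemovalCost` (S3, the bet, XL, HARDEST) — the three legs, in Kubo form.
* `SuperadditiveResistance_of` — kernel-checked composition, `C := 2C₁ + 2 max(C₃,0) + C₂`.

Disproof.lean (cdisprove, 2026-08-15T22:42Z; evidence store not mounted in this seat, read through its notes):
§1 shell-without-dynamics FALSE — honoured (S0a–S0d are about solutions of the chain's equations, S1–S3 about
their Kubo pairings; nothing is a statement on a free sequence `D`; `D` enters only through `stub_plainKuboLink`);
§2/§2b (bounded insertion cost ⟺ bounded `w`-second mfp-moment, `slab_doubling_defect_ge`) — S1–S3 are exactly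
this statistic in the kinetic caricature, no stub claims more; §3 (harmonic corner: no `C < 1/fluxLimit`) —
`C = 2C₁ + 2C₃⁺ + C₂` is parameter-dependent, no `C → 0` claimed; §4(iii) `lam = 0` log edge — `0 < lam, 0 < β`
are hypotheses of S1–S3. Landed `Negative/*` lemmas for this crux: none.
-/

noncomputable section

open MeasureTheory Filter Topology
open scoped ContDiff
open Literature.MathematicalPhysics.KineticTheory.HeatConduction
open Summit.AtomisticToContinuum.FouriersLaw.Theorems.SuperadditiveResistance.DeviceLiouville
  (kin deviceGenerator)

namespace Summit.AtomisticToContinuum.FouriersLaw.Cruxes.SuperadditiveResistance.FloatingProbeBypassLaplacian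

/-! ## §1 The equilibrium Kubo frame (local definitions; definition request D1' of the line) -/

/-- Terminal sites of the device for the split `(N, M)`: `0 ↦ 0` (left bath), `1 ↦ N−1`, `2 ↦ N` (the probe
pair), `3 ↦ N+M−1` (right bath). -/
def termSite (N M : ℕ) : Fin 4 → ℕ := ![0, N - 1, N, N + M - 1]

/-- The set of equilibrium FORWARD FIELDS of the device's terminal observable at site `s`:
classical `C²` solutions `g` of `L_dev g = −(p_s² − T)` (all four thermostats at `T`), square integrable and
mean zero for the Gibbs state `μ_T` (the clauses of the first lead's `IsForwardField` without its `S_K g ∈ L²`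
clause; a singleton or empty by the landed `forwardField_unique`). A solution SET (an object), not a proposition. -/
def deviceForwardFields (ω₂ lam β γ T : ℝ) (N M : ℕ) (s : ℕ) : Set (PhaseSpace (N + M) → ℝ) :=
  {g | ContDiff ℝ 2 g ∧ MemLp g 2 ((pinnedChain ω₂ lam β γ).gibbsMeasure (N + M) T) ∧
    ∫ x, g x ∂((pinnedChain ω₂ lam β γ).gibbsMeasure (N + M) T) = 0 ∧
    ∀ x, deviceGenerator (pinnedChain ω₂ lam β γ) N M (fun _ => T) g x = -(kin (N + M) s x - T)}

/-- The set of equilibrium forward fields of the LEFT bath of the plain `L`-chain: classical mean-zero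
`C² ∩ L²(μ_T)` solutions of `L_{T,T} g = −(p_0² − T)`. -/
def plainForwardFields (ω₂ lam β γ T : ℝ) (L : ℕ) : Set (PhaseSpace L → ℝ) :=
  {g | ContDiff ℝ 2 g ∧ MemLp g 2 ((pinnedChain ω₂ lam β γ).gibbsMeasure L T) ∧
    ∫ x, g x ∂((pinnedChain ω₂ lam β γ).gibbsMeasure L T) = 0 ∧
    ∀ x, (pinnedChain ω₂ lam β γ).generator L T T g x = -(kin L 0 x - T)}

/-- The plain chain's two-terminal KUBO CONDUCTANCE read off a left forward field:
`G = γ(1 − (γ/T²)⟨g, p_0² − T⟩_{μ_T})` (= `K_00` of the `2 × 2` Kubo matrix; by its zero row sum it is the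
linear-response current per unit bias `T_L − T_R`). -/
def plainKubo (ω₂ lam β γ T : ℝ) (L : ℕ) (g : PhaseSpace L → ℝ) : ℝ :=
  γ * (1 - γ / T ^ 2 * ∫ x, g x * (kin L 0 x - T) ∂((pinnedChain ω₂ lam β γ).gibbsMeasure L T))

/-- The device's four-terminal KUBO MATRIX from a family `g` of terminal forward fields:
`K_ab = γ δ_ab − (γ²/T²) ⟨g_a, p_{s_b}² − T⟩_{μ_T}` (`= ∂J_a/∂T_b`, `J_a = γ(T_a − ⟨p_{s_a}²⟩)`). -/
def kuboMatrix (ω₂ lam β γ T : ℝ) (N M : ℕ) (g : Fin 4 → PhaseSpace (N + M) → ℝ) :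
    Matrix (Fin 4) (Fin 4) ℝ :=
  fun a b => (if a = b then γ else 0) - γ ^ 2 / T ^ 2 *
    ∫ x, g a x * (kin (N + M) (termSite N M b) x - T) ∂((pinnedChain ω₂ lam β γ).gibbsMeasure (N + M) T)

/-- The set of four-terminal ONSAGER LAPLACIANS: symmetric, zero row sums, positive semidefinite, kernel =
constants (a cone of matrices — an object, not a proposition). -/
def onsagerLaplacians₄ : Set (Matrix (Fin 4) (Fin 4) ℝ) :=
  {K | K.IsSymm ∧ (∀ a, ∑ b, K a b = 0) ∧ (∀ θ : Fin 4 → ℝ, 0 ≤ ∑ a, ∑ b, θ a * K a b * θ b) ∧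
    (∀ θ : Fin 4 → ℝ, ∑ a, ∑ b, θ a * K a b * θ b = 0 → ∀ a b, θ a = θ b)}

/-- Merging the probe pair: terminal map `(0, 1, 2, 3) ↦ (0, 1, 1, 2)`. -/
def mergeMap : Fin 4 → Fin 3 := ![0, 1, 1, 2]

/-- The three-terminal matrix of the device with the probe pair MERGED (common temperature):
`(merge K)_{ij} = Σ_{σ a = i, σ b = j} K_ab`. -/
def merge (K : Matrix (Fin 4) (Fin 4) ℝ) : Matrix (Fin 3) (Fin 3) ℝ :=
  fun i j => ∑ a, ∑ b, if mergeMap a = i ∧ mergeMap b = j then K a b else 0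

/-- The set of three-terminal Onsager Laplacians: SYMMETRIC (Onsager reciprocity), ZERO ROW SUMS (no currents
at equal temperatures), POSITIVE SEMIDEFINITE (entropy production) with KERNEL = CONSTANTS. -/
def onsagerLaplacians : Set (Matrix (Fin 3) (Fin 3) ℝ) :=
  {𝓛 | 𝓛.IsSymm ∧ (∀ i : Fin 3, ∑ j : Fin 3, 𝓛 i j = 0) ∧
    (∀ θ : Fin 3 → ℝ, 0 ≤ ∑ i : Fin 3, ∑ j : Fin 3, θ i * 𝓛 i j * θ j) ∧
    (∀ θ : Fin 3 → ℝ, ∑ i : Fin 3, ∑ j : Fin 3, θ i * 𝓛 i j * θ j = 0 → θ 0 = θ 1 ∧ θ 1 = θ 2)}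

/-- The FLOATING conductance of a three-terminal matrix: bias `(δ/2, τδ, −δ/2)` with the merged pair's offset
`τ` fixed by zero net probe power; `G_dev = 𝓛₀₀/2 − 𝓛₀₂/2 + 𝓛₀₁ τ`, `τ = (𝓛₁₂ − 𝓛₁₀)/(2𝓛₁₁)`. For an
Onsager Laplacian this is the Schur complement `(ab − x²)/(a + b − 2x)` (`floatingConductance_eq`). -/
def floatingConductance (𝓛 : Matrix (Fin 3) (Fin 3) ℝ) : ℝ :=
  𝓛 0 0 / 2 - 𝓛 0 2 / 2 + 𝓛 0 1 * ((𝓛 1 2 - 𝓛 1 0) / (2 * 𝓛 1 1))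

/-! ## §2 The registered stubs -/

/-- **S0a (fixed-`N`, size L).** Existence of the plain chain's equilibrium forward field of the left bath for
every `L ≥ 2`: a classical mean-zero `C² ∩ L²(μ_T)` solution of `L_{T,T} g = −(p_0² − T)` for
`pinnedChain ω₂ lam β γ` (all `> 0`), `T > 0`. Content: the hypoelliptic Poisson problem at equilibrium
(`g = ∫₀^∞ P_t(p_0² − T) dt` by exponential convergence of the equilibrium semigroup, Cuneo–Eckmann–Hairer–
Rey-Bellet 2018 Thm 2.13(3) / Carmona 2007, and `C²` by Hörmander's theorem; or variationally). Uniqueness is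
the landed Liouville theorem. -/
theorem stub_plainForwardField :
    ∀ ω₂ lam β γ T : ℝ, 0 < ω₂ → 0 < lam → 0 < β → 0 < γ → 0 < T →
      ∀ L : ℕ, 2 ≤ L → ∃ g : PhaseSpace L → ℝ, g ∈ plainForwardFields ω₂ lam β γ T L := by
  sorry

/-- **S0b (fixed-`N`, size L).** Existence of the device's four terminal forward fields for every split
`N, M ≥ 2` (same analysis as S0a for the network with thermostats on `{0, N−1, N, N+M−1}`; shared with the first
lead's `stub_linearResponse`, clauses (iv)/(v) of its `DeviceFrame`). -/
theorem stub_deviceForwardFields :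
    ∀ ω₂ lam β γ T : ℝ, 0 < ω₂ → 0 < lam → 0 < β → 0 < γ → 0 < T →
      ∀ N M : ℕ, 2 ≤ N → 2 ≤ M → ∃ g : Fin 4 → PhaseSpace (N + M) → ℝ,
        ∀ a : Fin 4, g a ∈ deviceForwardFields ω₂ lam β γ T N M (termSite N M a) := by
  sorry

/-- **S0c — KUBO LINK (fixed-`N`, size L–XL; the only stub that sees the crux's NESS family).** Under the crux's
hypotheses (inlined verbatim: weak-NESS uniqueness, a steady-state family `μ`, its response coefficients `D > 0` at `T`):
for every `L ≥ 2` and every left forward field `g` of the plain `L`-chain,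
`D_L/(L−1) = γ(1 − (γ/T²)⟨g, p_0² − T⟩_{μ_T})` — the finite-volume Kubo formula (Rey-Bellet 2003 Rem. 4.4,
Kundu–Dhar–Narayan 2009). Content: first-order expansion of the unique weak NESS at `T ± δ/2` around the Gibbs
state tested against `g` (moment bounds uniform in `δ` from the tree's Lyapunov construction, cutoff extension of
the weak Fokker–Planck identity, continuity `μ_δ ⇀ μ_T` by uniqueness), and the steady-state energy balance
"left power = current through every bond" (so `totalCurrent = (L−1)·J_L`). -/
theorem stub_plainKuboLink :
    ∀ (ω₂ lam β γ : ℝ) (μ : (N : ℕ) → ℝ → ℝ → Measure (PhaseSpace N)) (T : ℝ) (D : ℕ → ℝ),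
      0 < ω₂ → 0 < lam → 0 < β → 0 < γ → 0 < T →
      (∀ (N : ℕ) (T_L T_R : ℝ), 0 < T_L → 0 < T_R → ∀ ρ ρ' : Measure (PhaseSpace N),
        (pinnedChain ω₂ lam β γ).IsSteadyState N T_L T_R ρ →
        (pinnedChain ω₂ lam β γ).IsSteadyState N T_L T_R ρ' → ρ = ρ') →
      (∀ (N : ℕ) (T_L T_R : ℝ), 0 < T_L → 0 < T_R →
        (pinnedChain ω₂ lam β γ).IsSteadyState N T_L T_R (μ N T_L T_R)) →
      (∀ N : ℕ, Tendsto (fun δ : ℝ =>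
        (pinnedChain ω₂ lam β γ).totalCurrent (μ N (T + δ / 2) (T - δ / 2)) / δ) (𝓝[≠] 0) (𝓝 (D N))) →
      (∀ N : ℕ, 2 ≤ N → 0 < D N) →
      ∀ L : ℕ, 2 ≤ L → ∀ g ∈ plainForwardFields ω₂ lam β γ T L,
        D L / ((L : ℝ) - 1) = plainKubo ω₂ lam β γ T L g := by
  sorry

/-- **S0d — KUBO–ONSAGER (fixed-`N`, size L; HELD BY THE LEAD).** For every split `N, M ≥ 2` and every family of
terminal forward fields of the device, the Kubo matrix is an Onsager Laplacian: SYMMETRIC (momentum reversal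
`Π`: `Πg_a` solves the adjoint equation, `μ_T` is `Π`-invariant, `p²` is even), ZERO ROW SUMS (energy
conservation: `L_dev H = −γ Σ_b (p_{s_b}² − T)`, so `⟨g_a, Σ_b k_b⟩ = ⟨H, k_a⟩/γ = T²/γ`), PSD with KERNEL THE
CONSTANTS (the identity `Σ_a ‖∂_{p_{s_a}} g_θ‖² + Σ_a ‖∂_{p_{s_a}}(g_θ − φ_θ)‖² = T|θ|²/γ²`,
`φ_θ = Σ_a θ_a p_{s_a}²/(2γ)`, and in the equality case the landed propagation `fderiv_eq_zero_of_liouville` applied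
to `g_θ − θ_0 H/γ`). -/
theorem stub_kuboOnsager :
    ∀ ω₂ lam β γ T : ℝ, 0 < ω₂ → 0 < lam → 0 < β → 0 < γ → 0 < T →
      ∀ N M : ℕ, 2 ≤ N → 2 ≤ M → ∀ g : Fin 4 → PhaseSpace (N + M) → ℝ,
        (∀ a : Fin 4, g a ∈ deviceForwardFields ω₂ lam β γ T N M (termSite N M a)) →
        kuboMatrix ω₂ lam β γ T N M g ∈ onsagerLaplacians₄ := by
  sorry

/-- **S1 — TERMINATION LOCALITY in Kubo form (TL⁺; the bet, size XL).** `∃ C₁ ∀ N, M ≥ 2`: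
`1/G_N − 1/K_00(N,M) ≤ C₁` and `1/G_M − 1/K_33(N,M) ≤ C₁`, where `G_N = plainKubo` of the bare `N`-chain (any of
its left forward fields — they are unique) and `K_00 = γ(1 − (γ/T²)⟨g_0, p_0² − T⟩)` is the left bath's
self-conductance in the `(N, M)` device. Content: the device differs from the bare `N`-chain only BEYOND the
γ-thermostatted site `N−1` (landed block restriction `pinnedChain_device_comp_restrictLeft`); whatever is
attached there lowers the resistance seen from bath `L` by at most a contact constant (renewal at a bathed site;
kinetic caricature: bounded `w`-second mfp-moment, Disproof §2b). ONE-SIDED; the sign of `1/G_N − 1/K_00` is not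
claimed (Ohmic caricature `> 0`, harmonic corner `< 0`). The right block uses the bare `M`-chain's LEFT forward
field (its two-terminal conductance is end-symmetric by the `2 × 2` zero row sums). -/
theorem stub_terminationLocality :
    ∀ ω₂ lam β γ T : ℝ, 0 < ω₂ → 0 < lam → 0 < β → 0 < γ → 0 < T →
      ∃ C₁ : ℝ, ∀ N M : ℕ, 2 ≤ N → 2 ≤ M →
        ∀ (g : Fin 4 → PhaseSpace (N + M) → ℝ) (gN : PhaseSpace N → ℝ) (gM : PhaseSpace M → ℝ),
          (∀ a : Fin 4, g a ∈ deviceForwardFields ω₂ lam β γ T N M (termSite N M a)) →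
          gN ∈ plainForwardFields ω₂ lam β γ T N → gM ∈ plainForwardFields ω₂ lam β γ T M →
          1 / plainKubo ω₂ lam β γ T N gN - 1 / kuboMatrix ω₂ lam β γ T N M g 0 0 ≤ C₁ ∧
            1 / plainKubo ω₂ lam β γ T M gM - 1 / kuboMatrix ω₂ lam β γ T N M g 3 3 ≤ C₁ := by
  sorry

/-- **S2 — BYPASS BOUND in Kubo form (FT re-sized; the bet, size L–XL).** `∃ C₃ ∀ N, M ≥ 2`:
`x(N,M) ≤ C₃ · K_00 · K_33` with `x = −K_03 = (γ²/T²)⟨g_0, p_{N+M−1}² − T⟩` the bypass conductance (linear heat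
transfer from bath `R` to bath `L` past the two γ-thermostatted junction sites; by `stub_kuboOnsager` also
`= (γ³/T) Σ_a ⟨∂_{p_{s_a}} g_0, ∂_{p_{s_a}} g_3⟩`). Content ("double escape"): one transmission factor per block.
UPPER bound only (a negative `x` helps). -/
theorem stub_bypassBound :
    ∀ ω₂ lam β γ T : ℝ, 0 < ω₂ → 0 < lam → 0 < β → 0 < γ → 0 < T →
      ∃ C₃ : ℝ, ∀ N M : ℕ, 2 ≤ N → 2 ≤ M → ∀ g : Fin 4 → PhaseSpace (N + M) → ℝ,
        (∀ a : Fin 4, g a ∈ deviceForwardFields ω₂ lam β γ T N M (termSite N M a)) →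
        -(kuboMatrix ω₂ lam β γ T N M g 0 3) ≤
          C₃ * kuboMatrix ω₂ lam β γ T N M g 0 0 * kuboMatrix ω₂ lam β γ T N M g 3 3 := by
  sorry

/-- **S3 — PROBE-REMOVAL COST in Kubo form (the bet, size XL; HARDEST stub).** `∃ C₂ ∀ N, M ≥ 2`:
`1/G_dev(N,M) − 1/G_{N+M} ≤ C₂` with `G_dev = floatingConductance (merge K)` the floating conductance of the
merged device and `G_{N+M} = plainKubo` of the bare `(N+M)`-chain: inserting a FLOATING, MERGED pair of
equal-friction thermostats on two adjacent interior sites raises the equilibrium linear-response resistance by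
at most a constant, uniformly in the position of the pair. Engines: the fixed-γ resolvent identity
`G^{probed} − G = −γ²⟨S_K ḡ, (I−Π_K) h⟩_{μ_T}` with a junction-roughness bound (triage-preferred), or friction
interpolation with the parity formula. Kinetic caricature: bounded second mfp-moment (Disproof §2b). -/
theorem stub_probeRemovalCost :
    ∀ ω₂ lam β γ T : ℝ, 0 < ω₂ → 0 < lam → 0 < β → 0 < γ → 0 < T →
      ∃ C₂ : ℝ, ∀ N M : ℕ, 2 ≤ N → 2 ≤ M →
        ∀ (g : Fin 4 → PhaseSpace (N + M) → ℝ) (gL : PhaseSpace (N + M) → ℝ),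
          (∀ a : Fin 4, g a ∈ deviceForwardFields ω₂ lam β γ T N M (termSite N M a)) →
          gL ∈ plainForwardFields ω₂ lam β γ T (N + M) →
          1 / floatingConductance (merge (kuboMatrix ω₂ lam β γ T N M g)) -
            1 / plainKubo ω₂ lam β γ T (N + M) gL ≤ C₂ := by
  sorry

/-! ## §3 Merging the pair preserves the Onsager-Laplacian structure (sorry-free) -/

/-- The quadratic form of the merged matrix is the quadratic form of `K` on the pulled-back vector. -/
theorem merge_quad (K : Matrix (Fin 4) (Fin 4) ℝ) (θ : Fin 3 → ℝ) :
    ∑ i, ∑ j, θ i * merge K i j * θ j = ∑ a, ∑ b, θ (mergeMap a) * K a b * θ (mergeMap b) := by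
  simp only [merge, mergeMap, Fin.sum_univ_four, Fin.sum_univ_three, Fin.isValue, Matrix.cons_val_zero,
    Matrix.cons_val_one, Matrix.cons_val]
  simp
  ring

/-- Entries of the merged matrix. -/
theorem merge_entries (K : Matrix (Fin 4) (Fin 4) ℝ) :
    merge K 0 0 = K 0 0 ∧ merge K 0 2 = K 0 3 ∧ merge K 2 0 = K 3 0 ∧ merge K 2 2 = K 3 3 ∧
      merge K 0 1 = K 0 1 + K 0 2 ∧ merge K 1 0 = K 1 0 + K 2 0 ∧
      merge K 1 2 = K 1 3 + K 2 3 ∧ merge K 2 1 = K 3 1 + K 3 2 ∧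
      merge K 1 1 = K 1 1 + K 1 2 + K 2 1 + K 2 2 := by
  refine ⟨?_, ?_, ?_, ?_, ?_, ?_, ?_, ?_, ?_⟩ <;>
    (simp [merge, mergeMap, Fin.sum_univ_four]; try ring)

/-- **Merging terminals of an Onsager Laplacian gives an Onsager Laplacian.** -/
theorem merge_mem_onsagerLaplacians {K : Matrix (Fin 4) (Fin 4) ℝ} (h : K ∈ onsagerLaplacians₄) :
    merge K ∈ onsagerLaplacians := by
  obtain ⟨hsym, hrow, hpsd, hker⟩ := h
  obtain ⟨e00, e02, e20, e22, e01, e10, e12, e21, e11⟩ := merge_entries K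
  have s := fun a b => hsym.apply a b
  refine ⟨?_, ?_, ?_, ?_⟩
  · -- symmetry
    ext i j
    fin_cases i <;> fin_cases j <;>
      (simp [Matrix.transpose_apply, e00, e02, e20, e22, e01, e10, e12, e21, e11, s 0 1, s 0 2, s 0 3,
        s 1 2, s 1 3, s 2 3]; try ring)
  · -- zero row sums
    intro i
    have r0 := hrow 0
    have r1 := hrow 1
    have r2 := hrow 2
    have r3 := hrow 3
    simp only [Fin.sum_univ_four] at r0 r1 r2 r3
    fin_cases i <;> simp [Fin.sum_univ_three, e00, e02, e20, e22, e01, e10, e12, e21, e11] <;> linarith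
  · -- positive semidefinite
    intro θ
    rw [merge_quad]
    exact hpsd _
  · -- kernel = constants
    intro θ hθ
    rw [merge_quad] at hθ
    have hc := hker _ hθ
    have h01 := hc 0 1
    have h13 := hc 1 3
    simp [mergeMap] at h01 h13
    exact ⟨h01, h13⟩

/-! ## §4 The exact algebra (sorry-free): Onsager Laplacian ⇒ positivity; Schur form of `G_dev`; series defect -/

/-- Entries of an Onsager Laplacian in conductance form. -/
theorem laplacian_entries {𝓛 : Matrix (Fin 3) (Fin 3) ℝ} (h : 𝓛 ∈ onsagerLaplacians) :
    𝓛 1 0 = 𝓛 0 1 ∧ 𝓛 2 0 = 𝓛 0 2 ∧ 𝓛 2 1 = 𝓛 1 2 ∧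
      𝓛 0 1 = -(𝓛 0 0) - 𝓛 0 2 ∧ 𝓛 1 2 = -(𝓛 2 2) - 𝓛 0 2 ∧
      𝓛 1 1 = 𝓛 0 0 + 𝓛 2 2 + 2 * 𝓛 0 2 := by
  obtain ⟨hsym, hrow, -, -⟩ := h
  have s10 : 𝓛 1 0 = 𝓛 0 1 := hsym.apply 0 1
  have s20 : 𝓛 2 0 = 𝓛 0 2 := hsym.apply 0 2
  have s21 : 𝓛 2 1 = 𝓛 1 2 := hsym.apply 1 2
  have r0 := hrow 0
  have r1 := hrow 1
  have r2 := hrow 2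
  simp only [Fin.sum_univ_three] at r0 r1 r2
  refine ⟨s10, s20, s21, ?_, ?_, ?_⟩
  · linarith
  · linarith
  · linarith

/-- Positivity consequences of an Onsager Laplacian: `a, b, m > 0` and the strict minor `x² < ab`. -/
theorem laplacian_pos {𝓛 : Matrix (Fin 3) (Fin 3) ℝ} (h : 𝓛 ∈ onsagerLaplacians) :
    0 < 𝓛 0 0 ∧ 0 < 𝓛 2 2 ∧ 0 < 𝓛 1 1 ∧ (𝓛 0 2) ^ 2 < 𝓛 0 0 * 𝓛 2 2 := by
  obtain ⟨s10, s20, s21, -, -, -⟩ := laplacian_entries h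
  obtain ⟨-, -, hpsd, hker⟩ := h
  have ha0 : 0 ≤ 𝓛 0 0 := by
    have := hpsd ![1, 0, 0]
    simpa [Fin.sum_univ_three] using this
  have ha : 0 < 𝓛 0 0 := by
    rcases ha0.lt_or_eq with hlt | heq
    · exact hlt
    · exfalso
      have hz : ∑ i : Fin 3, ∑ j : Fin 3, (![1, 0, 0] : Fin 3 → ℝ) i * 𝓛 i j * (![1, 0, 0] : Fin 3 → ℝ) j = 0 := by
        simp [Fin.sum_univ_three, ← heq]
      have := (hker _ hz).1
      simp at this
  have hb0 : 0 ≤ 𝓛 2 2 := by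
    have := hpsd ![0, 0, 1]
    simpa [Fin.sum_univ_three] using this
  have hb : 0 < 𝓛 2 2 := by
    rcases hb0.lt_or_eq with hlt | heq
    · exact hlt
    · exfalso
      have hz : ∑ i : Fin 3, ∑ j : Fin 3, (![0, 0, 1] : Fin 3 → ℝ) i * 𝓛 i j * (![0, 0, 1] : Fin 3 → ℝ) j = 0 := by
        simp [Fin.sum_univ_three, ← heq]
      have := (hker _ hz).2
      simp at this
  have hm0 : 0 ≤ 𝓛 1 1 := by
    have := hpsd ![0, 1, 0]
    simpa [Fin.sum_univ_three] using this
  have hm : 0 < 𝓛 1 1 := by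
    rcases hm0.lt_or_eq with hlt | heq
    · exact hlt
    · exfalso
      have hz : ∑ i : Fin 3, ∑ j : Fin 3, (![0, 1, 0] : Fin 3 → ℝ) i * 𝓛 i j * (![0, 1, 0] : Fin 3 → ℝ) j = 0 := by
        simp [Fin.sum_univ_three, ← heq]
      have := (hker _ hz).1
      simp at this
  have hq : ∑ i : Fin 3, ∑ j : Fin 3,
      (![-(𝓛 0 2), 0, 𝓛 0 0] : Fin 3 → ℝ) i * 𝓛 i j * (![-(𝓛 0 2), 0, 𝓛 0 0] : Fin 3 → ℝ) j =
        𝓛 0 0 * (𝓛 0 0 * 𝓛 2 2 - (𝓛 0 2) ^ 2) := by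
    simp [Fin.sum_univ_three, s20]
    ring
  have hmin0 : 0 ≤ 𝓛 0 0 * 𝓛 2 2 - (𝓛 0 2) ^ 2 := by
    have := hpsd ![-(𝓛 0 2), 0, 𝓛 0 0]
    rw [hq] at this
    exact (mul_nonneg_iff_of_pos_left ha).mp this
  have hmin : 0 < 𝓛 0 0 * 𝓛 2 2 - (𝓛 0 2) ^ 2 := by
    rcases hmin0.lt_or_eq with hlt | heq
    · exact hlt
    · exfalso
      have hz : ∑ i : Fin 3, ∑ j : Fin 3,
          (![-(𝓛 0 2), 0, 𝓛 0 0] : Fin 3 → ℝ) i * 𝓛 i j * (![-(𝓛 0 2), 0, 𝓛 0 0] : Fin 3 → ℝ) j = 0 := by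
        rw [hq, ← heq, mul_zero]
      have := (hker _ hz).2
      simp at this
      linarith
  exact ⟨ha, hb, hm, by linarith⟩

/-- **Schur form of the floating conductance.** `G_dev = (ab − x²)/(a + b − 2x)`. -/
theorem floatingConductance_eq {𝓛 : Matrix (Fin 3) (Fin 3) ℝ} (h : 𝓛 ∈ onsagerLaplacians) :
    floatingConductance 𝓛 =
      (𝓛 0 0 * 𝓛 2 2 - (𝓛 0 2) ^ 2) / (𝓛 0 0 + 𝓛 2 2 + 2 * 𝓛 0 2) := by
  obtain ⟨s10, s20, s21, e01, e12, e11⟩ := laplacian_entries h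
  obtain ⟨ha, hb, hm, hmin⟩ := laplacian_pos h
  have hm' : 𝓛 0 0 + 𝓛 2 2 + 2 * 𝓛 0 2 ≠ 0 := by rw [← e11]; exact ne_of_gt hm
  unfold floatingConductance
  rw [s10, e01, e12, e11]
  field_simp
  ring

/-- **Series defect of a floating node (pure real algebra).** -/
theorem series_defect_le {a b x C₃ : ℝ} (ha : 0 < a) (hb : 0 < b) (hmin : x ^ 2 < a * b)
    (hx : x ≤ C₃ * a * b) :
    1 / a + 1 / b - (a + b - 2 * x) / (a * b - x ^ 2) ≤ 2 * max C₃ 0 := by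
  have hd : 0 < a * b - x ^ 2 := by linarith
  have hab : 0 < a * b := mul_pos ha hb
  have key : 1 / a + 1 / b - (a + b - 2 * x) / (a * b - x ^ 2) =
      x * (2 * a * b - (a + b) * x) / (a * b * (a * b - x ^ 2)) := by
    field_simp
    ring
  rw [key]
  rcases le_or_gt x 0 with hx0 | hx0
  · have hnum : x * (2 * a * b - (a + b) * x) ≤ 0 := by
      have : 0 ≤ 2 * a * b - (a + b) * x := by nlinarith
      exact mul_nonpos_of_nonpos_of_nonneg hx0 this
    have : x * (2 * a * b - (a + b) * x) / (a * b * (a * b - x ^ 2)) ≤ 0 :=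
      div_nonpos_of_nonpos_of_nonneg hnum (by positivity)
    have hmax : (0 : ℝ) ≤ 2 * max C₃ 0 := by positivity
    linarith
  · have h2x : 2 * x < a + b := by nlinarith [sq_nonneg (a - b), sq_abs x]
    have hstep : x * (2 * a * b - (a + b) * x) / (a * b * (a * b - x ^ 2)) ≤ 2 * x / (a * b) := by
      rw [div_le_div_iff₀ (by positivity) hab]
      have hid : 2 * x * (a * b * (a * b - x ^ 2)) - x * (2 * a * b - (a + b) * x) * (a * b)
          = x ^ 2 * (a * b) * (a + b - 2 * x) := by ring
      have hnn : 0 ≤ x ^ 2 * (a * b) * (a + b - 2 * x) :=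
        mul_nonneg (mul_nonneg (sq_nonneg x) hab.le) (by linarith)
      linarith
    have hC : x / (a * b) ≤ C₃ := by
      rw [div_le_iff₀ hab]; linarith
    have hmax : C₃ ≤ max C₃ 0 := le_max_left _ _
    have : 2 * x / (a * b) = 2 * (x / (a * b)) := by ring
    linarith

/-- **Four-term decomposition ⇒ superadditivity defect bound (pure real algebra).** -/
theorem defect_le_of_legs {RN RM RL a b x C₁ C₂ C₃ : ℝ} (ha : 0 < a) (hb : 0 < b) (hmin : x ^ 2 < a * b)
    (h₁ : RN - 1 / a ≤ C₁) (h₂ : RM - 1 / b ≤ C₁) (h₃ : x ≤ C₃ * a * b)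
    (h₄ : (a + b - 2 * x) / (a * b - x ^ 2) - RL ≤ C₂) :
    RN + RM - (2 * C₁ + 2 * max C₃ 0 + C₂) ≤ RL := by
  have hs := series_defect_le ha hb hmin h₃
  linarith

/-! ## §5 Kernel-checked composition: the seven stubs prove the crux BY NAME -/

/-- **The line closes the crux.** S0a gives left forward fields of the bare `N`-, `M`- and `(N+M)`-chains, S0b the
device's terminal forward fields, S0c identifies `D_L/(L−1)` with the plain Kubo conductances, S0d makes the Kubo
matrix an Onsager Laplacian (hence its merge, `merge_mem_onsagerLaplacians`); S1, S2, S3 give `C₁, C₃, C₂`; then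
`laplacian_pos`, `floatingConductance_eq` and `defect_le_of_legs` yield `R_N + R_M − (2C₁ + 2max(C₃,0) + C₂) ≤ R_{N+M}`. -/
theorem SuperadditiveResistance_of :
    Summit.AtomisticToContinuum.FouriersLaw.Theses.JunctionLocality.SuperadditiveResistance := by
  intro ω₂ lam β γ hω hl hβ hγ hU μ hμ T hT D hD hpos
  obtain ⟨C₁, hC₁⟩ := stub_terminationLocality ω₂ lam β γ T hω hl hβ hγ hT
  obtain ⟨C₃, hC₃⟩ := stub_bypassBound ω₂ lam β γ T hω hl hβ hγ hT
  obtain ⟨C₂, hC₂⟩ := stub_probeRemovalCost ω₂ lam β γ T hω hl hβ hγ hT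
  refine ⟨2 * C₁ + 2 * max C₃ 0 + C₂, fun N M hN hM => ?_⟩
  -- S0a / S0b: forward fields of the pieces, of the whole, and of the device
  obtain ⟨gN, hgN⟩ := stub_plainForwardField ω₂ lam β γ T hω hl hβ hγ hT N hN
  obtain ⟨gM, hgM⟩ := stub_plainForwardField ω₂ lam β γ T hω hl hβ hγ hT M hM
  obtain ⟨gL, hgL⟩ := stub_plainForwardField ω₂ lam β γ T hω hl hβ hγ hT (N + M) (by omega)
  obtain ⟨g, hg⟩ := stub_deviceForwardFields ω₂ lam β γ T hω hl hβ hγ hT N M hN hM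
  -- S0c: the Kubo link for the three bare chains
  have kN := stub_plainKuboLink ω₂ lam β γ μ T D hω hl hβ hγ hT hU hμ hD hpos N hN gN hgN
  have kM := stub_plainKuboLink ω₂ lam β γ μ T D hω hl hβ hγ hT hU hμ hD hpos M hM gM hgM
  have kL := stub_plainKuboLink ω₂ lam β γ μ T D hω hl hβ hγ hT hU hμ hD hpos (N + M) (by omega) gL hgL
  have hcast : ((N + M : ℕ) : ℝ) - 1 = (N : ℝ) + (M : ℝ) - 1 := by push_cast; ring
  rw [hcast] at kL
  -- S0d: the merged Kubo matrix is an Onsager Laplacian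
  set K := kuboMatrix ω₂ lam β γ T N M g with hK
  have hons : merge K ∈ onsagerLaplacians :=
    merge_mem_onsagerLaplacians (stub_kuboOnsager ω₂ lam β γ T hω hl hβ hγ hT N M hN hM g hg)
  obtain ⟨e00, e02, e20, e22, -, -, -, -, -⟩ := merge_entries K
  -- S1 / S2 / S3
  obtain ⟨h₁, h₂⟩ := hC₁ N M hN hM g gN gM hg hgN hgM
  have h₃ := hC₃ N M hN hM g hg
  have h₄ := hC₂ N M hN hM g gL hg hgL
  obtain ⟨ha, hb, -, hmin⟩ := laplacian_pos hons
  rw [e00] at ha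
  rw [e22] at hb
  rw [e02, e00, e22] at hmin
  -- resistances of the pieces and of the whole in Kubo form
  have rN : ((N : ℝ) - 1) / D N = 1 / plainKubo ω₂ lam β γ T N gN := by rw [← kN, one_div_div]
  have rM : ((M : ℝ) - 1) / D M = 1 / plainKubo ω₂ lam β γ T M gM := by rw [← kM, one_div_div]
  have rL : ((N : ℝ) + (M : ℝ) - 1) / D (N + M) = 1 / plainKubo ω₂ lam β γ T (N + M) gL := by
    rw [← kL, one_div_div]
  rw [rN, rM, rL]
  -- 1/G_dev in Schur form
  have hG : 1 / floatingConductance (merge K) =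
      (K 0 0 + K 3 3 - 2 * (-(K 0 3))) / (K 0 0 * K 3 3 - (-(K 0 3)) ^ 2) := by
    rw [floatingConductance_eq hons, one_div_div, e00, e02, e22]
    congr 1 <;> ring
  rw [hG] at h₄
  have hmin' : (-(K 0 3)) ^ 2 < K 0 0 * K 3 3 := by simpa using hmin
  exact defect_le_of_legs ha hb hmin' h₁ h₂ h₃ h₄

end Summit.AtomisticToContinuum.FouriersLaw.Cruxes.SuperadditiveResistance.FloatingProbeBypassLaplacian

end
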